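import Mathlib
import HarnessLib
import Summits.ResolutionOfSingularities.ResolutionOfSingularities.Theorems.WildQuotientsWildQuotientResolutionCotangentRep
import Summits.ResolutionOfSingularities.ResolutionOfSingularities.Theorems.WildQuotientsWildQuotientResolutionCommonEigenvector
import Summits.ResolutionOfSingularities.ResolutionOfSingularities.Theorems.WildQuotientsWildQuotientResolutionPClosedEigenline

/-!
# The stable normal hyperplane of a stable centre (Kollár–Szabó going down, (K2-centres), linear-algebra half)
# (crux `WildQuotients.WildQuotientResolution`, stub `stub_phaseZeroHighDim`)

Crux stmt-ResolutionOfSingularities-15640 (`WildQuotientResolution`), registered stub `stub_phaseZeroHighDim`;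
programme PHASE0-KS-EIGENLINE, remaining item (K2-centres) of the lemma list of hands 8-g0/8-g1/8-g2
(memo MEMO-KS-BLOWUP-FIXEDPOINT.md v4): the Kollár–Szabó fixed point of the blow-up along a POSITIVE-DIMENSIONAL
`G`-stable centre `Z ∋ x` (the moves of the Phase-0 game), not only along points/orbits. The scheme side is
✓`KSGoingDown.exists_fixedPoint_liftAction_of_localChart_of_stalkIdeal` (p829964); the missing input is ALGEBRAIC and
starts with the fibre `I_x/𝔪I_x` of the centre ideal replacing the cotangent space `𝔪/𝔪²` of
✓`AbelianEigenline` / ✓`PClosedEigenline`. This file is that replacement, for an arbitrary `τ`-stable ideal `J` of a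
Noetherian local ring `(A, 𝔪, κ)` with a residue-trivial action `τ`:

* `exists_fibreRep` — the `κ`-LINEAR representation of `I` on the fibre `J/𝔪J` (`κ`-linearity from residue-triviality:
  `τ(a x) − a τ(x) = (τ a − a) τ x ∈ 𝔪J`);
* `finite_fibre`, `nontrivial_fibre` — `J/𝔪J` is finite-dimensional, and non-zero for `J ≠ 0` (Nakayama);
* `exists_stable_hyperplane_of_functional` — an `A`-linear `λ : J → κ`, `λ ≠ 0`, with `λ(τ_g x) = μ_g λ(x)` gives an
  ideal `𝔪J ≤ W < J`, `W + (t) = J` for every `t ∈ J ∖ W` (a HYPERPLANE of `J/𝔪J`), `τ_g W ⊆ W`;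
* ★ `exists_stable_hyperplane` (ABELIAN `I`, `κ` algebraically closed) and
  ★ `exists_stable_hyperplane_of_normal_isPGroup` (p-CLOSED `I ⊵ P ⊇ [I,I]`, `κ = κ̄` of characteristic `p`, via
  Kollár–Szabó Lemma A.1 ✓`PClosedEigenline.exists_common_eigencovector_of_normal_isPGroup`): such a `W` exists for
  every stable `J ≠ 0`;
* `exists_unit_mul_sub_mem_of_not_mem` — along any transversal `t ∈ J ∖ W` the eigenvalue is a UNIT:
  `τ_g t ≡ u·t (mod W)`.

Geometrically `[W]` is an `I`-fixed `κ`-point of the fibre `ℙ(J/𝔪J) = Proj Sym_κ (J/𝔪J)` of `Bl_J Spec A` over the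
closed point; with `J = 𝔪` these are hand 8-g0's statements verbatim. Next (not here): generators of `J` adapted to
`W` inside a regular system of parameters, and the `τ`-stable monoidal transform `A[J/t]_𝔫`.

[OURS · crux stmt-ResolutionOfSingularities-15640 · helper toward `stub_phaseZeroHighDim` ((K2-centres), linear
algebra half; NOT a proof of the stub); folklore local algebra after [ReichsteinYoussin2000, App., Lemma A.1 /
Prop. A.2], counted 0; AI-level work, weaker than expert review.] [folklore]
-/

-- single-problem summit: the doubled namespace component `ResolutionOfSingularities` is forced
set_option linter.dupNamespace false

namespace Summit.ResolutionOfSingularities.ResolutionOfSingularities.Theorems.WildQuotientResolution.CentreEigenline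

open IsLocalRing Module
open Summit.ResolutionOfSingularities.ResolutionOfSingularities.Theorems.WildQuotientResolution

variable {A : Type*} [CommRing A] [IsLocalRing A]
variable {I : Type*} [Group I] (τ : I →* (A ≃+* A)) (hres : ∀ (g : I) (a : A), τ g a - a ∈ maximalIdeal A)

/-! ## The fibre `J/𝔪J` of a stable ideal and its representation -/

/-- Scalars act on the fibre `J/𝔪J` through their residues. [folklore] -/
theorem mk_smul_mk_fibre (J : Ideal A) (a : A) (x : ↥J) :
    (Ideal.Quotient.mk (maximalIdeal A) a) •
        (Submodule.Quotient.mk x : ↥J ⧸ (maximalIdeal A • ⊤ : Submodule A ↥J)) =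
      Submodule.Quotient.mk (a • x) :=
  rfl

/-- The fibre `J/𝔪J` is a finite-dimensional `κ`-vector space (for `A` Noetherian). [folklore] -/
theorem finite_fibre [IsNoetherianRing A] (J : Ideal A) :
    Module.Finite (A ⧸ maximalIdeal A) (↥J ⧸ (maximalIdeal A • ⊤ : Submodule A ↥J)) := by
  haveI : IsScalarTower A (A ⧸ maximalIdeal A) (↥J ⧸ (maximalIdeal A • ⊤ : Submodule A ↥J)) :=
    IsScalarTower.of_algebraMap_smul fun a v => by
      obtain ⟨x, rfl⟩ := Submodule.Quotient.mk_surjective _ v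
      rw [Ideal.Quotient.algebraMap_eq, mk_smul_mk_fibre, Submodule.Quotient.mk_smul]
  exact Module.Finite.of_restrictScalars_finite A _ _

/-- **Nakayama**: the fibre `J/𝔪J` of a non-zero ideal of a Noetherian local ring is non-zero. [folklore] -/
theorem nontrivial_fibre [IsNoetherianRing A] (J : Ideal A) (hJ0 : J ≠ ⊥) :
    Nontrivial (↥J ⧸ (maximalIdeal A • ⊤ : Submodule A ↥J)) := by
  rw [Submodule.Quotient.nontrivial_iff]
  intro htop
  apply hJ0
  have h1 : Submodule.map J.subtype (maximalIdeal A • ⊤ : Submodule A ↥J) = Submodule.map J.subtype ⊤ := by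
    rw [htop]
  rw [Submodule.map_smul'', Submodule.map_subtype_top] at h1
  exact Submodule.eq_bot_of_le_smul_of_le_jacobson_bot (maximalIdeal A) J (IsNoetherian.noetherian J) h1.ge
    (IsLocalRing.maximalIdeal_le_jacobson ⊥)

include hres in
/-- **The fibre representation.** A residue-trivial action `τ` of `I` on `(A, 𝔪, κ)` stabilising the ideal `J` induces
a representation `ρ : I → End_κ(J/𝔪J)` by `κ`-LINEAR maps with `ρ g [x] = [τ g x]` (`κ`-linearity:
`τ(a x) − a τ(x) = (τ a − a)·τ x ∈ 𝔪J`). For `J = 𝔪` this is the cotangent representation ✓`CotangentRep`. [folklore] -/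
theorem exists_fibreRep (J : Ideal A) (hJ : ∀ g : I, ∀ a ∈ J, τ g a ∈ J) :
    ∃ ρ : I →* Module.End (A ⧸ maximalIdeal A) (↥J ⧸ (maximalIdeal A • ⊤ : Submodule A ↥J)),
      ∀ (g : I) (x : ↥J), ρ g (Submodule.Quotient.mk x) = Submodule.Quotient.mk ⟨τ g x, hJ g x x.2⟩ := by
  classical
  set N : Submodule A ↥J := maximalIdeal A • ⊤ with hN
  have hmemN : ∀ a : A, a ∈ maximalIdeal A → ∀ y : ↥J, a • y ∈ N := fun a ha y =>
    Submodule.smul_mem_smul ha Submodule.mem_top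
  -- the `A`-linear map `J → J/𝔪J`, `x ↦ [τ g x]`
  let T : I → (↥J →ₗ[A] ↥J ⧸ N) := fun g =>
    { toFun := fun x => Submodule.Quotient.mk ⟨τ g x, hJ g x x.2⟩
      map_add' := fun x y => by
        rw [← Submodule.Quotient.mk_add]
        congr 1
        exact Subtype.ext (by simp)
      map_smul' := fun a x => by
        rw [RingHom.id_apply, ← Submodule.Quotient.mk_smul, Submodule.Quotient.eq]
        have e : (⟨τ g ((a • x : ↥J) : A), hJ g _ (a • x).2⟩ : ↥J) - a • ⟨τ g x, hJ g x x.2⟩ =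
            (τ g a - a) • (⟨τ g x, hJ g x x.2⟩ : ↥J) :=
          Subtype.ext (by
            simp only [AddSubgroupClass.coe_sub, SetLike.val_smul, smul_eq_mul, map_mul]
            ring)
        rw [e]
        exact hmemN _ (hres g a) _ }
  have hT : ∀ (g : I) (x : ↥J), T g x = Submodule.Quotient.mk ⟨τ g x, hJ g x x.2⟩ := fun g x => rfl
  have hker : ∀ g : I, N ≤ LinearMap.ker (T g) := fun g =>
    Submodule.smul_le.mpr fun a ha y _ => by
      rw [LinearMap.mem_ker, map_smul, hT, ← Submodule.Quotient.mk_smul]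
      exact (Submodule.Quotient.mk_eq_zero N).mpr (hmemN a ha _)
  -- descend to the fibre
  let ψ : I → (↥J ⧸ N →ₗ[A] ↥J ⧸ N) := fun g => N.liftQ (T g) (hker g)
  have hψ : ∀ (g : I) (x : ↥J), ψ g (Submodule.Quotient.mk x) = Submodule.Quotient.mk ⟨τ g x, hJ g x x.2⟩ :=
    fun g x => by rw [Submodule.liftQ_apply, hT]
  -- `κ`-linearity
  let ψκ : I → Module.End (A ⧸ maximalIdeal A) (↥J ⧸ N) := fun g =>
    { toFun := ψ g
      map_add' := (ψ g).map_add
      map_smul' := fun c v => by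
        obtain ⟨a, rfl⟩ := Ideal.Quotient.mk_surjective c
        obtain ⟨x, rfl⟩ := Submodule.Quotient.mk_surjective N v
        change ψ g (Submodule.Quotient.mk (a • x)) =
          Ideal.Quotient.mk (maximalIdeal A) a • ψ g (Submodule.Quotient.mk x)
        rw [Submodule.Quotient.mk_smul, map_smul, hψ, mk_smul_mk_fibre, ← Submodule.Quotient.mk_smul] }
  have hψκ : ∀ (g : I) (x : ↥J), ψκ g (Submodule.Quotient.mk x) = Submodule.Quotient.mk ⟨τ g x, hJ g x x.2⟩ :=
    fun g x => hψ g x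
  refine ⟨{ toFun := ψκ, map_one' := ?_, map_mul' := ?_ }, fun g x => hψκ g x⟩
  · apply LinearMap.ext
    intro v
    obtain ⟨x, rfl⟩ := Submodule.Quotient.mk_surjective N v
    rw [hψκ, Module.End.one_apply]
    congr 1
    exact Subtype.ext (by simp)
  · intro g h
    apply LinearMap.ext
    intro v
    obtain ⟨x, rfl⟩ := Submodule.Quotient.mk_surjective N v
    rw [Module.End.mul_apply, hψκ, hψκ, hψκ]
    congr 1
    exact Subtype.ext (by simp)

/-! ## The hyperplane from an eigen-functional -/

/-- **Stable hyperplane from an eigen-functional.** Let `τ` act on `(A, 𝔪, κ)` by ring automorphisms stabilising the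
ideal `J`; let `λ : J → κ` be `A`-linear, non-zero, with `λ(τ g x) = μ_g · λ(x)`. Then `W :=` the preimage of `ker λ`
satisfies `𝔪J ≤ W ≤ J`, `W ≠ J`, `W + (t) = J` for every `t ∈ J ∖ W`, and `τ g (W) ⊆ W`. [folklore] -/
theorem exists_stable_hyperplane_of_functional (J : Ideal A) (hJ : ∀ g : I, ∀ a ∈ J, τ g a ∈ J)
    (l : ↥J →ₗ[A] (A ⧸ maximalIdeal A)) (hl : l ≠ 0)
    (hel : ∀ g : I, ∃ μ : A ⧸ maximalIdeal A, ∀ x : ↥J, l ⟨τ g x, hJ g x x.2⟩ = μ * l x) :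
    ∃ W : Ideal A, maximalIdeal A * J ≤ W ∧ W ≤ J ∧ W ≠ J ∧
      (∀ t ∈ J, t ∉ W → W ⊔ Ideal.span {t} = J) ∧ ∀ g : I, ∀ w ∈ W, τ g w ∈ W := by
  classical
  letI : Field (A ⧸ maximalIdeal A) := Ideal.Quotient.field _
  let W : Ideal A := (LinearMap.ker l).map J.subtype
  have memW : ∀ a : A, a ∈ W ↔ ∃ h : a ∈ J, l ⟨a, h⟩ = 0 := by
    intro a
    constructor
    · rintro ⟨y, hy, rfl⟩
      exact ⟨y.2, by simpa using hy⟩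
    · rintro ⟨h, hl0⟩
      exact ⟨⟨a, h⟩, by simpa using hl0, rfl⟩
  have hWle : W ≤ J := fun a ha => by
    obtain ⟨h, -⟩ := (memW a).mp ha
    exact h
  have hsmul : ∀ (a : A) (y : ↥J), l (a • y) = Ideal.Quotient.mk (maximalIdeal A) a * l y := fun a y => by
    rw [map_smul, Algebra.smul_def, Ideal.Quotient.algebraMap_eq]
  refine ⟨W, ?_, hWle, ?_, ?_, ?_⟩
  · -- `𝔪J ≤ W`
    refine Ideal.mul_le.mpr fun a ha b hb => (memW _).mpr ⟨J.mul_mem_left a hb, ?_⟩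
    have e : (⟨a * b, J.mul_mem_left a hb⟩ : ↥J) = a • ⟨b, hb⟩ := Subtype.ext (by simp)
    rw [e, hsmul, Ideal.Quotient.eq_zero_iff_mem.mpr ha, zero_mul]
  · -- `W ≠ J`: `λ ≠ 0`
    intro hWeq
    apply hl
    apply LinearMap.ext
    intro y
    have hyW : (y : A) ∈ W := by rw [hWeq]; exact y.2
    obtain ⟨h, h0⟩ := (memW y).mp hyW
    simpa using h0
  · -- hyperplane: `W + (t) = J` for `t ∈ J ∖ W`
    intro t ht htW
    have hlt : l ⟨t, ht⟩ ≠ 0 := fun h0 => htW ((memW t).mpr ⟨ht, h0⟩)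
    apply le_antisymm (sup_le hWle ((Ideal.span_singleton_le_iff_mem _).mpr ht))
    intro a ha
    -- `a - b t ∈ W` for a lift `b` of `λ[a] / λ[t]`
    obtain ⟨b, hb⟩ := Ideal.Quotient.mk_surjective (l ⟨a, ha⟩ / l ⟨t, ht⟩)
    have habt : a - b * t ∈ J := sub_mem ha (J.mul_mem_left b ht)
    have hW' : a - b * t ∈ W := by
      refine (memW _).mpr ⟨habt, ?_⟩
      have e : (⟨a - b * t, habt⟩ : ↥J) = ⟨a, ha⟩ - b • ⟨t, ht⟩ := Subtype.ext (by simp)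
      rw [e, map_sub, hsmul, hb, div_mul_cancel₀ _ hlt, sub_self]
    have e : a = (a - b * t) + b * t := by ring
    rw [e]
    exact Submodule.add_mem_sup hW' (Ideal.mul_mem_left _ b (Ideal.mem_span_singleton_self t))
  · -- stability under `I`
    intro g w hw
    obtain ⟨hwJ, hw0⟩ := (memW w).mp hw
    refine (memW _).mpr ⟨hJ g w hwJ, ?_⟩
    obtain ⟨μ, hμ⟩ := hel g
    rw [hμ ⟨w, hwJ⟩, hw0, mul_zero]

/-- From an eigen-covector of the fibre `J/𝔪J` to the eigen-functional on `J`. [folklore] -/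
theorem exists_stable_hyperplane_of_eigencovector (J : Ideal A) (hJ : ∀ g : I, ∀ a ∈ J, τ g a ∈ J)
    (l : Module.Dual (A ⧸ maximalIdeal A) (↥J ⧸ (maximalIdeal A • ⊤ : Submodule A ↥J))) (hl : l ≠ 0)
    (hel : ∀ g : I, ∃ μ : A ⧸ maximalIdeal A, ∀ x : ↥J,
      l (Submodule.Quotient.mk ⟨τ g x, hJ g x x.2⟩) = μ * l (Submodule.Quotient.mk x)) :
    ∃ W : Ideal A, maximalIdeal A * J ≤ W ∧ W ≤ J ∧ W ≠ J ∧
      (∀ t ∈ J, t ∉ W → W ⊔ Ideal.span {t} = J) ∧ ∀ g : I, ∀ w ∈ W, τ g w ∈ W := by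
  classical
  set N : Submodule A ↥J := maximalIdeal A • ⊤ with hN
  let l₀ : ↥J →ₗ[A] (A ⧸ maximalIdeal A) :=
    { toFun := fun x => l (Submodule.Quotient.mk x)
      map_add' := fun x y => by rw [Submodule.Quotient.mk_add, map_add]
      map_smul' := fun a x => by
        rw [RingHom.id_apply, ← mk_smul_mk_fibre, map_smul, smul_eq_mul, Algebra.smul_def,
          Ideal.Quotient.algebraMap_eq] }
  have hl₀ : ∀ x : ↥J, l₀ x = l (Submodule.Quotient.mk x) := fun x => rfl
  refine exists_stable_hyperplane_of_functional τ J hJ l₀ ?_ fun g => ?_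
  · intro h0
    apply hl
    apply LinearMap.ext
    intro v
    obtain ⟨x, rfl⟩ := Submodule.Quotient.mk_surjective N v
    rw [← hl₀, h0, LinearMap.zero_apply, LinearMap.zero_apply]
  · obtain ⟨μ, hμ⟩ := hel g
    exact ⟨μ, fun x => by rw [hl₀, hl₀, hμ]⟩

/-! ## The stable hyperplane: abelian and p-closed stabilisers -/

/-- **Stable normal hyperplane of an ABELIAN stabiliser along a stable centre.** For a residue-trivial action of an
abelian group `I` on a Noetherian local ring `(A, 𝔪, κ)` with `κ` algebraically closed, and a stable ideal `J ≠ 0`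
(the centre through the closed point), there is an ideal `W` with `𝔪J ≤ W ≤ J`, `W ≠ J`, `W + (t) = J` for every
`t ∈ J ∖ W` (a hyperplane of `J/𝔪J`), and `τ g (W) ⊆ W` for all `g`: an `I`-fixed `κ`-point `[W]` of the fibre
`ℙ(J/𝔪J)` of `Bl_J` over the closed point. [cite: ReichsteinYoussin2000, Appendix, proof of Prop. A.2] -/
theorem exists_stable_hyperplane [IsNoetherianRing A] {I : Type*} [CommGroup I] (τ : I →* (A ≃+* A))
    (hres : ∀ (g : I) (a : A), τ g a - a ∈ maximalIdeal A) [IsAlgClosed (ResidueField A)]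
    (J : Ideal A) (hJ0 : J ≠ ⊥) (hJ : ∀ g : I, ∀ a ∈ J, τ g a ∈ J) :
    ∃ W : Ideal A, maximalIdeal A * J ≤ W ∧ W ≤ J ∧ W ≠ J ∧
      (∀ t ∈ J, t ∉ W → W ⊔ Ideal.span {t} = J) ∧ ∀ g : I, ∀ w ∈ W, τ g w ∈ W := by
  letI : Field (A ⧸ maximalIdeal A) := Ideal.Quotient.field _
  haveI := finite_fibre (A := A) J
  haveI := nontrivial_fibre (A := A) J hJ0
  haveI : IsAlgClosed (A ⧸ maximalIdeal A) := ‹IsAlgClosed (ResidueField A)›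
  obtain ⟨ρ, hρ⟩ := exists_fibreRep τ hres J hJ
  obtain ⟨l, hl, hel⟩ := CommonEigenvector.exists_common_eigencovector_of_commute (fun g => ρ g) fun g h => by
    change ρ g * ρ h = ρ h * ρ g
    rw [← map_mul, ← map_mul, mul_comm]
  refine exists_stable_hyperplane_of_eigencovector τ J hJ l hl fun g => ?_
  obtain ⟨μ, hμ⟩ := hel g
  refine ⟨μ, fun x => ?_⟩
  have h := congrArg (fun f => f (Submodule.Quotient.mk x)) hμ
  simp only [LinearMap.coe_comp, Function.comp_apply, LinearMap.smul_apply, smul_eq_mul] at h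
  rw [hρ] at h
  exact h

include hres in
/-- **Stable normal hyperplane of a p-CLOSED stabiliser along a stable centre** (`I ⊵ P` a normal `p`-subgroup
containing the commutators — Kollár–Szabó Lemma A.1 shape, e.g. an inertia group with normal Sylow `p`-subgroup
and abelian tame quotient): for a residue-trivial action on a Noetherian local ring with ALGEBRAICALLY CLOSED residue
field of characteristic `p` and a stable ideal `J ≠ 0`, there is a stable hyperplane `𝔪J ≤ W < J` of `J/𝔪J`.
[cite: ReichsteinYoussin2000, Appendix, Lemma A.1 and proof of Prop. A.2] -/
theorem exists_stable_hyperplane_of_normal_isPGroup [IsNoetherianRing A] [Finite I] {p : ℕ} [Fact p.Prime]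
    [CharP (ResidueField A) p] [IsAlgClosed (ResidueField A)]
    (P : Subgroup I) [P.Normal] (hP : IsPGroup p P) (hcomm : ∀ g h : I, g * h * g⁻¹ * h⁻¹ ∈ P)
    (J : Ideal A) (hJ0 : J ≠ ⊥) (hJ : ∀ g : I, ∀ a ∈ J, τ g a ∈ J) :
    ∃ W : Ideal A, maximalIdeal A * J ≤ W ∧ W ≤ J ∧ W ≠ J ∧
      (∀ t ∈ J, t ∉ W → W ⊔ Ideal.span {t} = J) ∧ ∀ g : I, ∀ w ∈ W, τ g w ∈ W := by
  letI : Field (A ⧸ maximalIdeal A) := Ideal.Quotient.field _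
  haveI := finite_fibre (A := A) J
  haveI := nontrivial_fibre (A := A) J hJ0
  haveI : IsAlgClosed (A ⧸ maximalIdeal A) := ‹IsAlgClosed (ResidueField A)›
  haveI : CharP (A ⧸ maximalIdeal A) p := ‹CharP (ResidueField A) p›
  obtain ⟨ρ, hρ⟩ := exists_fibreRep τ hres J hJ
  obtain ⟨l, hl, hel⟩ := PGroupEigenline.exists_common_eigencovector_of_normal_isPGroup P hP hcomm ρ
  refine exists_stable_hyperplane_of_eigencovector τ J hJ l hl fun g => ?_
  obtain ⟨μ, hμ⟩ := hel g
  refine ⟨μ, fun x => ?_⟩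
  have h := congrArg (fun f => f (Submodule.Quotient.mk x)) hμ
  simp only [LinearMap.coe_comp, Function.comp_apply, LinearMap.smul_apply, smul_eq_mul] at h
  rw [hρ] at h
  exact h

/-! ## The eigenvalue along a transversal generator is a unit -/

/-- **The eigenvalue along a transversal generator of the centre is a unit.** For ANY ideal `W` with `𝔪J ≤ W`,
`τ g (W) ⊆ W` for all `g`, and `t ∈ J ∖ W` with `W + (t) = J` (`J` stable): `τ g t ≡ u·t (mod W)` with `u` a unit —
in the blow-up chart `D₊(t)` of `Bl_J`, `τ g t / t` is a unit at the fixed point `[W]`. [folklore] -/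
theorem exists_unit_mul_sub_mem_of_not_mem (J : Ideal A) (hJ : ∀ g : I, ∀ a ∈ J, τ g a ∈ J)
    (W : Ideal A) (hWJ : maximalIdeal A * J ≤ W) (hstab : ∀ g : I, ∀ w ∈ W, τ g w ∈ W)
    {t : A} (ht : t ∈ J) (htW : t ∉ W) (hsup : W ⊔ Ideal.span {t} = J) (g : I) :
    ∃ u : A, IsUnit u ∧ τ g t - u * t ∈ W := by
  -- `τ g t ∈ J = W + (t)`: `τ g t = w + u t`
  have hgt : τ g t ∈ J := hJ g t ht
  rw [← hsup] at hgt
  obtain ⟨w, hw, c, hc, hwc⟩ := Submodule.mem_sup.mp hgt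
  obtain ⟨u, rfl⟩ := Ideal.mem_span_singleton'.mp hc
  refine ⟨u, ?_, by rw [← hwc]; simpa using hw⟩
  -- if `u ∈ 𝔪` then `u t ∈ 𝔪J ≤ W`, so `τ g t ∈ W`, and applying `τ g⁻¹` gives `t ∈ W`
  by_contra hu
  have hum : u ∈ maximalIdeal A := (IsLocalRing.mem_maximalIdeal u).mpr (mem_nonunits_iff.mpr hu)
  have hut : u * t ∈ W := hWJ (Ideal.mul_mem_mul hum ht)
  have hgtW : τ g t ∈ W := by rw [← hwc]; exact add_mem hw hut
  have : t ∈ W := by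
    have h := hstab g⁻¹ _ hgtW
    rwa [← RingAut.mul_apply, ← map_mul, inv_mul_cancel, map_one, RingAut.one_apply] at h
  exact htW this

end Summit.ResolutionOfSingularities.ResolutionOfSingularities.Theorems.WildQuotientResolution.CentreEigenline
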